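import Literature.NumberTheory.EllipticCurves.ShintaniKernelLevel64
import Literature.NumberTheory.EllipticCurves.Gamma0FundamentalDomain
import Literature.NumberTheory.EllipticCurves.Gamma0PlusFreeAction
import HarnessLib

/-!
# The action of `Γ₀(64)⁺` on the lattice coordinates `ℤ³` of `L♮`; equivariance of the kernel terms; definite stabilisers

[[cite: Shintani1975, §2 (2.8), (2.12), Prop. 2.3]] — for the unfolding of the twisted Shintani
lift (`ShintaniLift`) the theta kernel `∑_{k ∈ ℤ³} c_D(k) f_{w,Z}(ι♮ k)` is regrouped over the
orbits of `Γ = Γ₀(64)⁺` (`Gamma0FundamentalDomain`) on the coordinates `k` of `L♮`.  We DEFINE this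
action and PROVE its basic properties:

* `latMulAction` — the left action `γ • k = k ∘ γ⁻¹` (`actSharp` with the entries
  `(d, -b, -c/64, a)` of `γ⁻¹`; `ShintaniKernelLevel64.actSharp_actSharp` for `mul_smul`);
* `latSharp_smul : ι♮(γ • k) = ι♮(k) ∘ γ⁻¹`, `disc_latSharp_smul` (the discriminant is invariant),
  `invWeight_smul` (a `Γ₀(64)`-invariant weight, e.g. `c_D`, is invariant);
* `shintaniFn_latSharp_smul` — **equivariance** `f_{w,Z}(ι♮(γ • k)) = j(γ⁻¹, w)² f_{γ⁻¹w,Z}(ι♮ k)`,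
  so `φ(w) f_{w,Z}(ι♮(γ•k)) = φ(γ⁻¹ w) f_{γ⁻¹ w,Z}(ι♮ k)` for `φ` of weight `2`;
* `root_unique`, **`eq_one_of_smul_eq_of_disc_neg`** — a DEFINITE vector (`disc ι♮(k) < 0`) has
  trivial stabiliser in `Γ₀(64)⁺`: a stabilising `γ` fixes the root of the form in `ℍ`, and
  `Γ₀(64)⁺` acts freely (`Gamma0PlusFreeAction`).

No named facts; the definitions are `cq` (`c/64`), `latSmul` and the `MulAction` instance.
-/

noncomputable section

open scoped MatrixGroups
open UpperHalfPlane hiding I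
open Complex CongruenceSubgroup
open Literature.NumberTheory.EllipticCurves.ModularForms

namespace Literature.NumberTheory.EllipticCurves.Shintani

/-! ### The action `γ • k = k ∘ γ⁻¹` on `ℤ³` -/

/-- `c/64` for `γ ∈ Γ₀(64)⁺`. [folklore] -/
def cq (γ : Gamma0Plus 64) : ℤ := ((γ : SL(2, ℤ)) 1 0 : ℤ) / 64

/-- `64 · (c/64) = c` on `Γ₀(64)⁺`. [folklore] -/
theorem sixtyfour_mul_cq (γ : Gamma0Plus 64) : 64 * cq γ = ((γ : SL(2, ℤ)) 1 0 : ℤ) := by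
  have h : (64 : ℤ) ∣ ((γ : SL(2, ℤ)) 1 0 : ℤ) := by
    have h0 : ((((γ : SL(2, ℤ)) 1 0 : ℤ)) : ZMod 64) = 0 := Gamma0_mem.mp (Gamma0Plus_le γ.2)
    exact (ZMod.intCast_zmod_eq_zero_iff_dvd _ 64).mp h0
  exact Int.mul_ediv_cancel' h

/-- The entries of a product in `Γ₀(64)⁺`. [folklore] -/
theorem coe_mul_apply (γ δ : Gamma0Plus 64) (i j : Fin 2) :
    (((γ * δ : Gamma0Plus 64) : SL(2, ℤ)) i j : ℤ) =
      (γ : SL(2, ℤ)) i 0 * (δ : SL(2, ℤ)) 0 j + (γ : SL(2, ℤ)) i 1 * (δ : SL(2, ℤ)) 1 j := by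
  rw [Subgroup.coe_mul]; simp [Matrix.mul_apply, Fin.sum_univ_two]

/-- `c/64` is multiplicative in the expected way: `cq(γδ) = cq(γ) δ₀₀ + γ₁₁ cq(δ)`. [folklore] -/
theorem cq_mul (γ δ : Gamma0Plus 64) :
    cq (γ * δ) = cq γ * (δ : SL(2, ℤ)) 0 0 + (γ : SL(2, ℤ)) 1 1 * cq δ := by
  have hγc := sixtyfour_mul_cq γ
  have hδc := sixtyfour_mul_cq δ
  have hπc := sixtyfour_mul_cq (γ * δ)
  have e10 := coe_mul_apply γ δ 1 0
  have : 64 * cq (γ * δ) = 64 * (cq γ * (δ : SL(2, ℤ)) 0 0 + (γ : SL(2, ℤ)) 1 1 * cq δ) := by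
    rw [hπc, e10, ← hγc, ← hδc]; ring
  linarith

/-- The action map `γ • k := k ∘ γ⁻¹` on coordinates: `actSharp` with the entries
`(d, -b, -c/64, a)` of `γ⁻¹`. [cite: Shintani1975, §2 (2.8)] -/
def latSmul (γ : Gamma0Plus 64) (k : Fin 3 → ℤ) : Fin 3 → ℤ :=
  actSharp ((γ : SL(2, ℤ)) 1 1) (-((γ : SL(2, ℤ)) 0 1)) (-cq γ) ((γ : SL(2, ℤ)) 0 0) k

/-- `1 • k = k`. [folklore] -/
theorem latSmul_one (k : Fin 3 → ℤ) : latSmul 1 k = k := by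
  unfold latSmul
  have hc : cq 1 = 0 := by unfold cq; simp
  rw [hc]
  simpa using actSharp_one k

/-- `(γδ) • k = γ • (δ • k)`. [folklore] -/
theorem latSmul_mul (γ δ : Gamma0Plus 64) (k : Fin 3 → ℤ) :
    latSmul (γ * δ) k = latSmul γ (latSmul δ k) := by
  unfold latSmul
  rw [actSharp_actSharp, coe_mul_apply γ δ 1 1, coe_mul_apply γ δ 0 1, coe_mul_apply γ δ 0 0, cq_mul]
  have hγc := sixtyfour_mul_cq γ
  have hδc := sixtyfour_mul_cq δ
  congr 1
  · linear_combination (-((δ : SL(2, ℤ)) 0 1 : ℤ)) * hγc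
  · ring
  · ring
  · linear_combination (-((γ : SL(2, ℤ)) 0 1 : ℤ)) * hδc

/-- **The (left) action of `Γ₀(64)⁺` on the coordinates `k ∈ ℤ³` of `L♮`**, `γ • k = k ∘ γ⁻¹`.
[cite: Shintani1975, §2 (2.8)] -/
instance latMulAction : MulAction (Gamma0Plus 64) (Fin 3 → ℤ) where
  smul := latSmul
  one_smul := latSmul_one
  mul_smul := latSmul_mul

/-- Unfolding the action. [folklore] -/
theorem smul_def (γ : Gamma0Plus 64) (k : Fin 3 → ℤ) :
    γ • k = actSharp ((γ : SL(2, ℤ)) 1 1) (-((γ : SL(2, ℤ)) 0 1)) (-cq γ) ((γ : SL(2, ℤ)) 0 0) k := rfl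

/-- **`ι♮(γ • k) = ι♮(k) ∘ γ⁻¹`** on `V`. [folklore] -/
theorem latSharp_smul (γ : Gamma0Plus 64) (k : Fin 3 → ℤ) :
    latSharp (γ • k) = actV ((γ : SL(2, ℤ)) 1 1 : ℤ) ((-((γ : SL(2, ℤ)) 0 1) : ℤ) : ℝ)
      ((-((γ : SL(2, ℤ)) 1 0) : ℤ) : ℝ) ((γ : SL(2, ℤ)) 0 0 : ℤ) (latSharp k) := by
  rw [smul_def, latSharp_actSharp]
  congr 1
  rw [← sixtyfour_mul_cq γ]; push_cast; ring

/-- The discriminant is invariant: `disc ι♮(γ • k) = disc ι♮(k)`. [folklore] -/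
theorem disc_latSharp_smul (γ : Gamma0Plus 64) (k : Fin 3 → ℤ) :
    disc (latSharp (γ • k)) = disc (latSharp k) := by
  rw [latSharp_smul, disc_actV]
  have hdet : (((γ : SL(2, ℤ)) 1 1 : ℤ) : ℝ) * (((γ : SL(2, ℤ)) 0 0 : ℤ) : ℝ) -
      ((-((γ : SL(2, ℤ)) 0 1) : ℤ) : ℝ) * ((-((γ : SL(2, ℤ)) 1 0) : ℤ) : ℝ) = 1 := by
    have h : ((γ : SL(2, ℤ)) 0 0 : ℝ) * (γ : SL(2, ℤ)) 1 1 - (γ : SL(2, ℤ)) 0 1 * (γ : SL(2, ℤ)) 1 0 = 1 := by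
      exact_mod_cast det_eq_one' (γ : SL(2, ℤ))
    push_cast
    linear_combination h
  rw [hdet, one_pow, one_mul]

/-- A `Γ₀(64)`-invariant weight is invariant under the action: `c(γ • k) = c(k)`. [folklore] -/
theorem invWeight_smul {c : (Fin 3 → ℤ) → ℂ} (hc : InvWeight c) (γ : Gamma0Plus 64) (k : Fin 3 → ℤ) :
    c (γ • k) = c k := by
  rw [smul_def]
  refine hc _ _ _ _ ?_ k
  have := det_eq_one' (γ : SL(2, ℤ))
  have h64 := sixtyfour_mul_cq γ
  linear_combination this - ((γ : SL(2, ℤ)) 0 1 : ℤ) * h64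

/-- The entries of `γ⁻¹`. [folklore] -/
theorem inv_apply (γ : SL(2, ℤ)) :
    (γ⁻¹) 0 0 = γ 1 1 ∧ (γ⁻¹) 0 1 = -γ 0 1 ∧ (γ⁻¹) 1 0 = -γ 1 0 ∧ (γ⁻¹) 1 1 = γ 0 0 := by
  rw [Matrix.SpecialLinearGroup.SL2_inv_expl]
  exact ⟨rfl, rfl, rfl, rfl⟩

/-- **Equivariance of the kernel terms**: `f_{w,Z}(ι♮(γ • k)) = j(γ⁻¹, w)² f_{γ⁻¹ w, Z}(ι♮ k)`, so that
`φ(w) f_{w,Z}(ι♮(γ•k)) = φ(γ⁻¹w) f_{γ⁻¹w,Z}(ι♮ k)` for `φ` of weight `2`. [cite: Shintani1975, (2.12)] -/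
theorem shintaniFn_latSharp_smul (γ : Gamma0Plus 64) (k : Fin 3 → ℤ) (w Z : ℍ) :
    shintaniFn w Z (latSharp (γ • k)) =
      ((((γ : SL(2, ℤ))⁻¹ 1 0 : ℤ) : ℂ) * w + (((γ : SL(2, ℤ))⁻¹ 1 1 : ℤ) : ℂ)) ^ 2 *
        shintaniFn ((γ : SL(2, ℤ))⁻¹ • w) Z (latSharp k) := by
  obtain ⟨h00, h01, h10, h11⟩ := inv_apply (γ : SL(2, ℤ))
  rw [latSharp_smul, ← shintaniFn_sl_smul, h00, h01, h10, h11]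

/-! ### Definite vectors have trivial stabilisers -/

/-- A real binary quadratic form `x₀ u² + x₁ u + x₂` with `x₀ ≠ 0` has at most one root in `ℍ`.
[folklore] -/
theorem root_unique {x : V} (hx : x 0 ≠ 0) {u u' : ℂ} (hu : 0 < u.im) (hu' : 0 < u'.im)
    (h : formEval x u = 0) (h' : formEval x u' = 0) : u = u' := by
  -- `x₀ (u - u')(u + u' + x₁/x₀) = 0`; the second factor has positive imaginary part
  unfold formEval at h h'
  have hx0 : ((x 0 : ℝ) : ℂ) ≠ 0 := Complex.ofReal_ne_zero.mpr hx
  have hdiff : ((x 0 : ℝ) : ℂ) * (u - u') * (u + u' + (x 1 : ℝ) / (x 0 : ℝ)) = 0 := by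
    field_simp
    linear_combination h - h'
  rcases mul_eq_zero.mp hdiff with h1 | h1
  · rcases mul_eq_zero.mp h1 with h2 | h2
    · exact absurd h2 hx0
    · exact sub_eq_zero.mp h2
  · exfalso
    have := congrArg Complex.im h1
    simp only [add_im, Complex.div_ofReal_im, Complex.ofReal_im, zero_div, add_zero,
      Complex.zero_im] at this
    linarith

/-- **Definite vectors have trivial stabilisers in `Γ₀(64)⁺`**: if `ι♮(k)` has negative
discriminant and `γ • k = k` for `γ ∈ Γ₀(64)⁺`, then `γ = 1` (`γ⁻¹` fixes the root of the form in
`ℍ`, and `Γ₀(64)⁺` acts freely). [folklore] -/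
theorem eq_one_of_smul_eq_of_disc_neg {k : Fin 3 → ℤ} (hk : disc (latSharp k) < 0) {γ : Gamma0Plus 64}
    (hγ : γ • k = k) : γ = 1 := by
  set x : V := latSharp k with hxdef
  have hx0 : x 0 ≠ 0 := by
    intro h0
    have : disc x = x 1 ^ 2 := by rw [disc, h0]; ring
    rw [this] at hk
    nlinarith [sq_nonneg (x 1)]
  -- the root `ω = -x₁/(2x₀) + i √(-disc)/(2|x₀|)` in `ℍ`
  obtain ⟨ω, hωim, hω⟩ : ∃ ω : ℂ, 0 < ω.im ∧ formEval x ω = 0 := by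
    set s : ℝ := Real.sqrt (-disc x) with hs
    have hs2 : s ^ 2 = -disc x := Real.sq_sqrt (by linarith)
    have hspos : 0 < s := Real.sqrt_pos.mpr (by linarith)
    set p : ℝ := -x 1 / (2 * x 0) with hp
    set q : ℝ := s / (2 * |x 0|) with hq
    have habs : 0 < |x 0| := abs_pos.mpr hx0
    have hqpos : 0 < q := by positivity
    have hp' : 2 * x 0 * p + x 1 = 0 := by rw [hp]; field_simp; ring
    have hq2 : 4 * x 0 ^ 2 * q ^ 2 = s ^ 2 := by
      rw [hq, div_pow, mul_pow, sq_abs]; field_simp; norm_num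
    have hreal : x 0 * (p * p - q * q) + x 1 * p + x 2 = 0 := by
      have hx4 : (4 : ℝ) * x 0 ≠ 0 := by positivity
      have key : (x 0 * (p * p - q * q) + x 1 * p + x 2) * (4 * x 0) = 0 := by
        have hd : disc x = x 1 ^ 2 - 4 * x 0 * x 2 := rfl
        nlinarith [hp', hq2, hs2, hd]
      rcases mul_eq_zero.mp key with h | h
      · exact h
      · exact absurd h hx4
    have himag : x 0 * (2 * p * q) + x 1 * q = 0 := by nlinarith [hp']
    refine ⟨(p : ℂ) + (q : ℂ) * I, by simpa using hqpos, ?_⟩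
    rw [formEval, Complex.ext_iff]
    constructor
    · simp only [pow_two, add_re, mul_re, mul_im, add_im, Complex.ofReal_re, Complex.ofReal_im,
        Complex.I_re, Complex.I_im, mul_zero, sub_zero, zero_mul, add_zero, mul_one, Complex.zero_re]
      linear_combination hreal
    · simp only [pow_two, add_re, mul_re, mul_im, add_im, Complex.ofReal_re, Complex.ofReal_im,
        Complex.I_re, Complex.I_im, mul_zero, sub_zero, zero_mul, add_zero, mul_one, zero_add,
        Complex.zero_im]
      linear_combination himag
  -- `γ⁻¹` fixes `ω`
  set g : SL(2, ℤ) := (γ : SL(2, ℤ))⁻¹ with hg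
  obtain ⟨h00, h01, h10, h11⟩ := inv_apply (γ : SL(2, ℤ))
  have hfixV : actV ((g 0 0 : ℤ)) ((g 0 1 : ℤ)) ((g 1 0 : ℤ)) ((g 1 1 : ℤ)) x = x := by
    rw [hg, h00, h01, h10, h11, ← latSharp_smul, hγ]
  let ωH : ℍ := ⟨ω, hωim⟩
  have hden : ((g 1 0 : ℤ) : ℂ) * ω + ((g 1 1 : ℤ) : ℂ) ≠ 0 := by
    have h := UpperHalfPlane.denom_ne_zero (g : GL (Fin 2) ℝ) ωH
    rw [ModularGroup.denom_apply] at h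
    exact_mod_cast h
  have hroot' : formEval x ((((g 0 0 : ℤ) : ℂ) * ω + (g 0 1 : ℤ)) / (((g 1 0 : ℤ) : ℂ) * ω + (g 1 1 : ℤ))) = 0 := by
    have h := formEval_actV ((g 0 0 : ℤ)) ((g 0 1 : ℤ)) ((g 1 0 : ℤ)) ((g 1 1 : ℤ)) x (u := ω)
      (by exact_mod_cast hden)
    rw [hfixV, hω] at h
    push_cast at h ⊢
    rcases mul_eq_zero.mp h.symm with h1 | h1
    · exact absurd (pow_eq_zero_iff two_ne_zero |>.mp h1) (by exact_mod_cast hden)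
    · exact h1
  have hgω : ((g • ωH : ℍ) : ℂ) = ((((g 0 0 : ℤ) : ℂ) * ω + (g 0 1 : ℤ)) / (((g 1 0 : ℤ) : ℂ) * ω + (g 1 1 : ℤ))) := by
    rw [coe_smul_eq']
  have hfix : g • ωH = ωH := by
    apply UpperHalfPlane.ext
    rw [hgω]
    exact root_unique hx0 (by rw [← hgω]; exact (g • ωH).im_pos) hωim hroot' hω
  have hg1 : g = 1 := eq_one_of_mem_Gamma0Plus_of_smul_eq ((Gamma0Plus 64).inv_mem γ.2) hfix
  have : (γ : SL(2, ℤ)) = 1 := by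
    have := congrArg (·⁻¹) hg1
    simpa [hg] using this
  exact Subtype.ext this

end Literature.NumberTheory.EllipticCurves.Shintani
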